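import Summits.QuantumFields.YangMills.Theorems.DressedRitz.Negative.BlockToFineLoadBearing
import HarnessLib

/-!
# Route `LuscherReduction`, crux `DressedRitz` (stmt-QuantumFields-20205), line «polyakovlift» r8 — NEGATIVE lane:
# BOTH block-defect hypotheses of the reverse Jensen root `BlockToFine.reverse_jensen_root` (b) are load-bearing

Negative-side support lemmas of the standing disprover (seat `ym-cdisprove-20205-1`, GEN 12, second file; work file `Cruxes/DressedRitz/Disproof.lean` §16).
Nothing here asserts a route item; nothing here refutes one.  Sequel of `BlockToFineLoadBearing.lean` (p587358: the same for the defect contraction (c)).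

CONTEXT.  The lead (ym-lead-20205-polyakovlift g4) landed the block-to-fine door (p586508) and the block text `BlockLeakageForL` (p586831, raw AND dressed
block defects `≤ Cλ³`), and announced «door part 2»: the TWO-SIDED Ritz clause (o5) from the block Rayleigh quotient via (a) `jensen_root`
(`⟨u,Ku⟩^ℓ ≤ ⟨u,Pu⟩‖u‖^{2(ℓ−1)}`, hypothesis-free) and (b) `reverse_jensen_root` (`⟨u,Pu⟩‖u‖^{2(ℓ−1)} ≤ e^{15δ}⟨u,Ku⟩^ℓ` under BOTH block defects `≤ δ ≤ 1/32`),
`u = K^ℓ v`, `P = K^ℓ`.  This file records, kernel-checked and for EVERY constant `c` in place of `15`, that neither block-defect hypothesis of (b) can be omitted: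

* ★ `reverse_jensen_root_false_without_raw` (§2): drop the RAW block defect (H1) ⇒ false for every `c`.  Witness (`L = 1`, `β = 1`, exact physical eigenpair
  `κ₂ ≤ κ₁/2`): the FAR-LOWER atom `v = ψ₁ + s•ψ₂` whose DRESSED weight on the lower level is `q² = 1/(64(|c|+1)²)` (`s = q·κ₁^ℓ/κ₂^ℓ` — a huge raw weight,
  which is what (H1) forbids), `δ := q²`, `ℓ = n + 1 > 8(|c|+1)² + 1`: (H2) holds, but `‖u‖^{2(ℓ−1)}` carries `(1+q²)^{ℓ−1} ≥ 1 + (ℓ−1)q²/3·…` while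
  `e^{cδ}(⟨u,Ku⟩/…)^ℓ` gains only `e^{cq²}(1+q²/2)^ℓ`.  So a lower (o5)-type bound from block data needs the raw clause: dressed-only data lose by a factor growing in `ℓ = L`.
* ★ `reverse_jensen_root_false_without_dressed` (§3): drop the DRESSED block defect (H2) ⇒ false for every `c`, already at `ℓ = 2`.  Witness: the UPWARD atom
  `v = ψ₂ + (τr²)•ψ₁` (`κ₂ = rκ₁`, `r ≤ τ² = 1/(64(|c|+1)²)`), `δ := τ²`: (H1) holds while `⟨u,P u⟩‖u‖² = κ₁^{10}r⁸(r²+τ²)(1+τ²) ≥ κ₁^{10}r⁸τ²` against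
  `e^{cδ}⟨u,Ku⟩² = e^{cτ²}κ₁^{10}r⁸(r+τ²)² ≤ 4e^{1/64}τ⁴κ₁^{10}r⁸`.
§1 is the pure-real arithmetic of the two atoms; the two-level block data and the far eigenpair come from `BlockToFineLoadBearing.lean` §1–§2.

HONEST FRAMING: fixed-lattice linear algebra about the HYPOTHESES of a door lemma of a child of the CONDITIONAL reduction route R2b1; no stub is closed or refuted;
nothing here bears on infinite volume, the continuum limit or the Clay mass gap.  [folklore]; spectral calculus as in Reed–Simon IV, Thm. XIII.1
[cite: ReedSimonIV1978, Thm. XIII.1]; block-time effective masses: M. Lüscher, U. Wolff, NPB 339 (1990) 222 [cite: LuscherWolff1990].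
-/

set_option autoImplicit false

noncomputable section

open MeasureTheory Filter Topology Real
open Literature.MathematicalPhysics.QuantumFieldTheory (GaugeConfig Site gaugeTransform)
open scoped BigOperators

namespace Summit.QuantumFields.YangMills.Theorems.FemtoTransferGap.PolyakovLift.Negative

open Summit.QuantumFields.YangMills.Theorems.FemtoTransferGap
open Summit.QuantumFields.YangMills.Theorems.FemtoTransferGap.PolyakovLift

/-! ## §1 Pure-real lemmas: the far-lower atom and the upward atom at `ℓ = 2` -/

section Arith

/-- Dressed block defect of the far-lower atom: `X²(X²+q²Y²)·X²(1+q²) ≤ (1+q²)·(X²(X+q²Y))²` for `0 < Y ≤ X`. [folklore] -/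
theorem dressedBlockDefect_farLowerAtom {X Y : ℝ} (hX : 0 < X) (hY : 0 < Y) (hYX : Y ≤ X) (q : ℝ) :
    X ^ 2 * (X ^ 2 + q ^ 2 * Y ^ 2) * (X ^ 2 * (1 + q ^ 2)) ≤ (1 + q ^ 2) * (X ^ 2 * (X + q ^ 2 * Y)) ^ 2 := by
  have hcore : X ^ 2 + q ^ 2 * Y ^ 2 ≤ (X + q ^ 2 * Y) ^ 2 := by
    nlinarith [mul_nonneg (mul_nonneg (sq_nonneg q) hY.le) (show 0 ≤ 2 * X - Y by linarith), sq_nonneg (q ^ 2 * Y)]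
  have hk : 0 ≤ X ^ 4 * (1 + q ^ 2) := by positivity
  calc X ^ 2 * (X ^ 2 + q ^ 2 * Y ^ 2) * (X ^ 2 * (1 + q ^ 2)) = X ^ 4 * (1 + q ^ 2) * (X ^ 2 + q ^ 2 * Y ^ 2) := by ring
    _ ≤ X ^ 4 * (1 + q ^ 2) * (X + q ^ 2 * Y) ^ 2 := mul_le_mul_of_nonneg_left hcore hk
    _ = (1 + q ^ 2) * (X ^ 2 * (X + q ^ 2 * Y)) ^ 2 := by ring

/-- The far-lower atom contradicts every reverse-Jensen constant `c` once `n > 8(|c|+1)²` (`ℓ = n+1`, `X = κ₁^{n+1}`, `0 < Y`, `κ₂ ≤ κ₁/2`,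
`q = 1/(8(|c|+1))`): `(X+q²Y)(1+q²)^n ≤ e^{cq²}(κ₁+q²κ₂)^{n+1}` is impossible, by Bernoulli for `(1+q²/3)^n` against `e^{cq²}(1+q²/2) ≤ (64/63)(129/128)`.
[folklore] -/
theorem farLowerAtom_contra {κ₁ κ₂ X Y q c : ℝ} {n : ℕ} (hκ₁ : 0 < κ₁) (hκ₂ : 0 < κ₂) (hle : κ₂ ≤ κ₁ / 2)
    (hX : X = κ₁ ^ (n + 1)) (hY : 0 < Y) (hq : q = 1 / (8 * (|c| + 1))) (hn : 8 * (|c| + 1) ^ 2 < n)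
    (hc : X ^ 2 * (X + q ^ 2 * Y) * (X ^ 2 * (1 + q ^ 2)) ^ n ≤ Real.exp (c * q ^ 2) * (X ^ 2 * (κ₁ + q ^ 2 * κ₂)) ^ (n + 1)) : False := by
  have habs : 0 ≤ |c| := abs_nonneg c
  have hXpos : 0 < X := by rw [hX]; exact pow_pos hκ₁ _
  have hqpos : 0 < q := by rw [hq]; positivity
  have hq8 : q * (8 * (|c| + 1)) = 1 := by rw [hq]; exact div_mul_cancel₀ 1 (by positivity)
  have hqc : q * (|c| + 1) = 1 / 8 := by linarith
  have hsq : q ^ 2 * (|c| + 1) ^ 2 = 1 / 64 := by rw [← mul_pow, hqc]; norm_num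
  have hq2 : q ^ 2 ≤ 1 / 64 := by nlinarith [sq_nonneg q, mul_nonneg (sq_nonneg q) habs, mul_nonneg (sq_nonneg q) (sq_nonneg |c|)]
  have hcq : c * q ^ 2 ≤ 1 / 64 := by
    have h1 : c * q ^ 2 ≤ |c| * q ^ 2 := mul_le_mul_of_nonneg_right (le_abs_self c) (sq_nonneg q)
    nlinarith [sq_nonneg q, mul_nonneg (sq_nonneg q) habs, mul_nonneg (sq_nonneg q) (sq_nonneg |c|)]
  have hexp : Real.exp (c * q ^ 2) ≤ 64 / 63 :=
    (Real.exp_le_exp.2 hcq).trans ((Real.exp_bound_div_one_sub_of_interval (by norm_num) (by norm_num)).trans_eq (by norm_num))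
  have hnq : 1 / 8 < (n : ℝ) * q ^ 2 := by
    have := mul_lt_mul_of_pos_right hn (pow_pos hqpos 2)
    linarith
  -- strip the common factor (X²)^(n+1)
  rw [mul_pow, mul_pow] at hc
  have hW : 0 < (X ^ 2) ^ n * X ^ 2 := by positivity
  have key : (X ^ 2) ^ n * X ^ 2 * ((X + q ^ 2 * Y) * (1 + q ^ 2) ^ n) ≤
      (X ^ 2) ^ n * X ^ 2 * (Real.exp (c * q ^ 2) * (κ₁ + q ^ 2 * κ₂) ^ (n + 1)) := by
    calc (X ^ 2) ^ n * X ^ 2 * ((X + q ^ 2 * Y) * (1 + q ^ 2) ^ n)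
        = X ^ 2 * (X + q ^ 2 * Y) * ((X ^ 2) ^ n * (1 + q ^ 2) ^ n) := by ring
      _ ≤ Real.exp (c * q ^ 2) * ((X ^ 2) ^ (n + 1) * (κ₁ + q ^ 2 * κ₂) ^ (n + 1)) := hc
      _ = (X ^ 2) ^ n * X ^ 2 * (Real.exp (c * q ^ 2) * (κ₁ + q ^ 2 * κ₂) ^ (n + 1)) := by rw [pow_succ]; ring
  have hc1 : (X + q ^ 2 * Y) * (1 + q ^ 2) ^ n ≤ Real.exp (c * q ^ 2) * (κ₁ + q ^ 2 * κ₂) ^ (n + 1) :=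
    le_of_mul_le_mul_left key hW
  -- lower bound X(1+q²)^n, upper bound e^{cq²}·X·(1+q²/2)^(n+1)
  have hlow : X * (1 + q ^ 2) ^ n ≤ (X + q ^ 2 * Y) * (1 + q ^ 2) ^ n :=
    mul_le_mul_of_nonneg_right (by nlinarith [sq_nonneg q]) (by positivity)
  have hbase : κ₁ + q ^ 2 * κ₂ ≤ κ₁ * (1 + q ^ 2 / 2) := by nlinarith [sq_nonneg q]
  have hup : (κ₁ + q ^ 2 * κ₂) ^ (n + 1) ≤ X * (1 + q ^ 2 / 2) ^ (n + 1) := by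
    rw [hX, ← mul_pow]; exact pow_le_pow_left₀ (by positivity) hbase _
  have hc2 : X * (1 + q ^ 2) ^ n ≤ X * (Real.exp (c * q ^ 2) * (1 + q ^ 2 / 2) ^ (n + 1)) := by
    calc X * (1 + q ^ 2) ^ n ≤ Real.exp (c * q ^ 2) * (κ₁ + q ^ 2 * κ₂) ^ (n + 1) := hlow.trans hc1
      _ ≤ Real.exp (c * q ^ 2) * (X * (1 + q ^ 2 / 2) ^ (n + 1)) := mul_le_mul_of_nonneg_left hup (Real.exp_pos _).le
      _ = X * (Real.exp (c * q ^ 2) * (1 + q ^ 2 / 2) ^ (n + 1)) := by ring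
  have hc3 : (1 + q ^ 2) ^ n ≤ Real.exp (c * q ^ 2) * (1 + q ^ 2 / 2) ^ (n + 1) := le_of_mul_le_mul_left hc2 hXpos
  -- split (1+q²) ≥ (1+q²/2)(1+q²/3) and cancel (1+q²/2)^n
  have hsplit0 : (1 + q ^ 2 / 2) * (1 + q ^ 2 / 3) ≤ 1 + q ^ 2 := by nlinarith [sq_nonneg q, mul_le_mul_of_nonneg_left hq2 (sq_nonneg q)]
  have hsplit : (1 + q ^ 2 / 2) ^ n * (1 + q ^ 2 / 3) ^ n ≤ (1 + q ^ 2) ^ n := by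
    rw [← mul_pow]; exact pow_le_pow_left₀ (by positivity) hsplit0 n
  have hP : 0 < (1 + q ^ 2 / 2) ^ n := by positivity
  have hc4 : (1 + q ^ 2 / 2) ^ n * (1 + q ^ 2 / 3) ^ n ≤ (1 + q ^ 2 / 2) ^ n * (Real.exp (c * q ^ 2) * (1 + q ^ 2 / 2)) := by
    calc (1 + q ^ 2 / 2) ^ n * (1 + q ^ 2 / 3) ^ n ≤ Real.exp (c * q ^ 2) * (1 + q ^ 2 / 2) ^ (n + 1) := hsplit.trans hc3
      _ = (1 + q ^ 2 / 2) ^ n * (Real.exp (c * q ^ 2) * (1 + q ^ 2 / 2)) := by rw [pow_succ]; ring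
  have hc5 : (1 + q ^ 2 / 3) ^ n ≤ Real.exp (c * q ^ 2) * (1 + q ^ 2 / 2) := le_of_mul_le_mul_left hc4 hP
  -- Bernoulli and the numerical bounds
  have hbern : 1 + (n : ℝ) * (q ^ 2 / 3) ≤ (1 + q ^ 2 / 3) ^ n :=
    one_add_mul_le_pow (by linarith [sq_nonneg q] : (-2 : ℝ) ≤ q ^ 2 / 3) n
  have hR : Real.exp (c * q ^ 2) * (1 + q ^ 2 / 2) ≤ 64 / 63 * (129 / 128) :=
    mul_le_mul hexp (by linarith) (by positivity) (by norm_num)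
  linarith

/-- Raw block defect of the upward atom at `ℓ = 2`: `(r⁴κ₁⁴ + τ²r⁴κ₁⁴)(1 + τ²r⁴) ≤ (1+τ²)(r²κ₁² + τ²r⁴κ₁²)²` for `0 < r ≤ 1`
(stated in the exponent shape produced by the two-level lemmas at `n = 2·2, 2`). [folklore] -/
theorem rawBlockDefect_upwardAtom_two {κ₁ r : ℝ} (τ : ℝ) (hκ₁ : 0 < κ₁) (hr : 0 < r) (hr1 : r ≤ 1) :
    ((r * κ₁) ^ (2 * 2) + (τ * r ^ 2) ^ 2 * κ₁ ^ (2 * 2)) * (1 + (τ * r ^ 2) ^ 2) ≤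
      (1 + τ ^ 2) * ((r * κ₁) ^ 2 + (τ * r ^ 2) ^ 2 * κ₁ ^ 2) ^ 2 := by
  have h42 : r ^ 4 ≤ r ^ 2 := pow_le_pow_of_le_one hr.le hr1 (by norm_num)
  have hcore : 1 + τ ^ 2 * r ^ 4 ≤ (1 + τ ^ 2 * r ^ 2) ^ 2 := by
    nlinarith [mul_le_mul_of_nonneg_left h42 (sq_nonneg τ), sq_nonneg (τ ^ 2 * r ^ 2)]
  have hk : 0 ≤ κ₁ ^ 4 * r ^ 4 * (1 + τ ^ 2) := by positivity
  calc ((r * κ₁) ^ (2 * 2) + (τ * r ^ 2) ^ 2 * κ₁ ^ (2 * 2)) * (1 + (τ * r ^ 2) ^ 2)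
      = κ₁ ^ 4 * r ^ 4 * (1 + τ ^ 2) * (1 + τ ^ 2 * r ^ 4) := by ring
    _ ≤ κ₁ ^ 4 * r ^ 4 * (1 + τ ^ 2) * (1 + τ ^ 2 * r ^ 2) ^ 2 := mul_le_mul_of_nonneg_left hcore hk
    _ = (1 + τ ^ 2) * ((r * κ₁) ^ 2 + (τ * r ^ 2) ^ 2 * κ₁ ^ 2) ^ 2 := by ring

/-- The upward atom at `ℓ = 2` contradicts every reverse-Jensen constant `c` (`τ = 1/(8(|c|+1))`, `0 < r ≤ τ²`): `(r²+τ²)(1+τ²) ≤ e^{cτ²}(r+τ²)²` is impossible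
(stated in the exponent shape produced by the two-level lemmas at `m = 2`). [folklore] -/
theorem upwardAtomTwo_contra {κ₁ r τ c : ℝ} (hκ₁ : 0 < κ₁) (hr : 0 < r) (hτ : τ = 1 / (8 * (|c| + 1))) (hrt : r ≤ τ ^ 2)
    (hc : ((r * κ₁) ^ (2 + (2 + 2)) + (τ * r ^ 2) ^ 2 * κ₁ ^ (2 + (2 + 2))) *
        ((r * κ₁) ^ (2 * 2) + (τ * r ^ 2) ^ 2 * κ₁ ^ (2 * 2)) ^ (2 - 1) ≤
      Real.exp (c * τ ^ 2) * ((r * κ₁) ^ (2 * 2 + 1) + (τ * r ^ 2) ^ 2 * κ₁ ^ (2 * 2 + 1)) ^ 2) : False := by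
  have habs : 0 ≤ |c| := abs_nonneg c
  have hτpos : 0 < τ := by rw [hτ]; positivity
  have hτ8 : τ * (8 * (|c| + 1)) = 1 := by rw [hτ]; exact div_mul_cancel₀ 1 (by positivity)
  have hτc : τ * (|c| + 1) = 1 / 8 := by linarith
  have hsq : τ ^ 2 * (|c| + 1) ^ 2 = 1 / 64 := by rw [← mul_pow, hτc]; norm_num
  have hτ2 : τ ^ 2 ≤ 1 / 64 := by nlinarith [sq_nonneg τ, mul_nonneg (sq_nonneg τ) habs, mul_nonneg (sq_nonneg τ) (sq_nonneg |c|)]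
  have hcτ : c * τ ^ 2 ≤ 1 / 64 := by
    have h1 : c * τ ^ 2 ≤ |c| * τ ^ 2 := mul_le_mul_of_nonneg_right (le_abs_self c) (sq_nonneg τ)
    nlinarith [sq_nonneg τ, mul_nonneg (sq_nonneg τ) habs, mul_nonneg (sq_nonneg τ) (sq_nonneg |c|)]
  have hexp : Real.exp (c * τ ^ 2) ≤ 64 / 63 :=
    (Real.exp_le_exp.2 hcτ).trans ((Real.exp_bound_div_one_sub_of_interval (by norm_num) (by norm_num)).trans_eq (by norm_num))
  rw [show (2 : ℕ) - 1 = 1 from rfl, pow_one] at hc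
  have hW : 0 < κ₁ ^ 10 * r ^ 8 := by positivity
  have hc' : κ₁ ^ 10 * r ^ 8 * ((r ^ 2 + τ ^ 2) * (1 + τ ^ 2)) ≤ κ₁ ^ 10 * r ^ 8 * (Real.exp (c * τ ^ 2) * (r + τ ^ 2) ^ 2) := by
    calc κ₁ ^ 10 * r ^ 8 * ((r ^ 2 + τ ^ 2) * (1 + τ ^ 2))
        = ((r * κ₁) ^ (2 + (2 + 2)) + (τ * r ^ 2) ^ 2 * κ₁ ^ (2 + (2 + 2))) *
            ((r * κ₁) ^ (2 * 2) + (τ * r ^ 2) ^ 2 * κ₁ ^ (2 * 2)) := by ring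
      _ ≤ Real.exp (c * τ ^ 2) * ((r * κ₁) ^ (2 * 2 + 1) + (τ * r ^ 2) ^ 2 * κ₁ ^ (2 * 2 + 1)) ^ 2 := hc
      _ = κ₁ ^ 10 * r ^ 8 * (Real.exp (c * τ ^ 2) * (r + τ ^ 2) ^ 2) := by ring
  have hc2 : (r ^ 2 + τ ^ 2) * (1 + τ ^ 2) ≤ Real.exp (c * τ ^ 2) * (r + τ ^ 2) ^ 2 := le_of_mul_le_mul_left hc' hW
  have hsq2 : (r + τ ^ 2) ^ 2 ≤ (2 * τ ^ 2) ^ 2 := pow_le_pow_left₀ (by positivity) (by linarith) 2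
  have h1 : τ ^ 2 ≤ (r ^ 2 + τ ^ 2) * (1 + τ ^ 2) := by
    nlinarith [sq_nonneg r, sq_nonneg τ, mul_nonneg (sq_nonneg r) (sq_nonneg τ), pow_nonneg (sq_nonneg τ) 2]
  have h2 : Real.exp (c * τ ^ 2) * (r + τ ^ 2) ^ 2 ≤ 64 / 63 * (2 * τ ^ 2) ^ 2 :=
    mul_le_mul hexp hsq2 (by positivity) (by norm_num)
  have h3 : τ ^ 2 ≤ 64 / 63 * (2 * τ ^ 2) ^ 2 := h1.trans (hc2.trans h2)
  nlinarith [mul_le_mul_of_nonneg_left hτ2 (sq_nonneg τ), pow_pos hτpos 2]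

end Arith

/-! ## §2 ★ (H1) is load-bearing for (b): without the RAW block defect no constant `c` gives `⟨u,Pu⟩‖u‖^{2(ℓ−1)} ≤ e^{cδ}⟨u,Ku⟩^ℓ` -/

section WithoutRaw

/-- ★ **`BlockToFine.reverse_jensen_root` is FALSE without its raw-block-defect hypothesis (H1), for EVERY constant `c` in place of `15`.**
Witness: `L = 1`, `β = 1`, a physical eigenpair with `0 < κ₂ ≤ κ₁/2`, the far-lower atom `v = ψ₁ + s•ψ₂` with dressed lower weight `q² = 1/(64(|c|+1)²)`
(`s²κ₂^{2ℓ} = q²κ₁^{2ℓ}`), `δ := q²`, `ℓ = n + 1`, `n > 8(|c|+1)²`.  So a lower (o5)-type Ritz bound from block data needs the RAW clause of `BlockLeakageForL`.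
[folklore] -/
theorem reverse_jensen_root_false_without_raw :
    ¬ ∃ c : ℝ, ∀ (L : ℕ) [NeZero L] (β : ℝ), 0 < β → ∀ (v : GaugeConfig 3 L SU2 → ℝ), IsPhys v → ∀ (ℓ : ℕ), 1 ≤ ℓ →
      ∀ (δ : ℝ), 0 ≤ δ → δ ≤ 1 / 32 → 0 < l2 ((transferApply β)^[ℓ] v) ((transferApply β)^[ℓ] v) →
      l2 ((transferApply β)^[ℓ] v) ((transferApply β)^[2 * ℓ] ((transferApply β)^[ℓ] v)) *
          l2 ((transferApply β)^[ℓ] v) ((transferApply β)^[ℓ] v) ≤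
        (1 + δ) * l2 ((transferApply β)^[ℓ] v) ((transferApply β)^[ℓ] ((transferApply β)^[ℓ] v)) ^ 2 →
      l2 ((transferApply β)^[ℓ] v) ((transferApply β)^[ℓ] ((transferApply β)^[ℓ] v)) *
          l2 ((transferApply β)^[ℓ] v) ((transferApply β)^[ℓ] v) ^ (ℓ - 1) ≤
        Real.exp (c * δ) * l2 ((transferApply β)^[ℓ] v) (transferApply β ((transferApply β)^[ℓ] v)) ^ ℓ := by
  rintro ⟨c, h⟩
  have habs : 0 ≤ |c| := abs_nonneg c
  obtain ⟨ψ₁, ψ₂, κ₁, κ₂, h₁, h₂, hn₁, hn₂, h₁₂, he₁, he₂, hκ₁, hκ₂, hle⟩ :=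
    exists_eigenpair_ratio_le (L := 1) (β := 1) one_pos (ρ := 1 / 2) (by norm_num) (by norm_num)
  have hκ₂le : κ₂ ≤ κ₁ / 2 := by linarith
  obtain ⟨n, hn⟩ := exists_nat_gt (8 * (|c| + 1) ^ 2)
  obtain ⟨q, hqpos, hq⟩ : ∃ q : ℝ, 0 < q ∧ q = 1 / (8 * (|c| + 1)) := ⟨_, by positivity, rfl⟩
  have hXpos : 0 < κ₁ ^ (n + 1) := pow_pos hκ₁ _
  have hYpos : 0 < κ₂ ^ (n + 1) := pow_pos hκ₂ _
  have hYX : κ₂ ^ (n + 1) ≤ κ₁ ^ (n + 1) := pow_le_pow_left₀ hκ₂.le (by linarith) _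
  -- the raw weight s with DRESSED weight q²: s²·κ₂^{2ℓ} = q²·κ₁^{2ℓ}
  obtain ⟨s, hsY⟩ : ∃ s : ℝ, s ^ 2 * (κ₂ ^ (n + 1)) ^ 2 = q ^ 2 * (κ₁ ^ (n + 1)) ^ 2 :=
    ⟨q * κ₁ ^ (n + 1) / κ₂ ^ (n + 1), by rw [div_pow, div_mul_cancel₀ _ (pow_ne_zero 2 hYpos.ne'), mul_pow]⟩
  have p2 : ∀ κ : ℝ, κ ^ (2 * (n + 1)) = (κ ^ (n + 1)) ^ 2 := fun κ => by rw [pow_mul']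
  have p3 : ∀ κ : ℝ, κ ^ ((n + 1) + ((n + 1) + (n + 1))) = (κ ^ (n + 1)) ^ 3 := fun κ => by
    rw [← pow_mul, show (n + 1) * 3 = (n + 1) + ((n + 1) + (n + 1)) by ring]
  have p4 : ∀ κ : ℝ, κ ^ ((n + 1) + (2 * (n + 1) + (n + 1))) = (κ ^ (n + 1)) ^ 4 := fun κ => by
    rw [← pow_mul, show (n + 1) * 4 = (n + 1) + (2 * (n + 1) + (n + 1)) by ring]
  -- block data of u = K^{n+1}(ψ₁ + s•ψ₂)
  have e1 : l2 ((transferApply (1 : ℝ))^[n + 1] (ψ₁ + s • ψ₂)) ((transferApply 1)^[n + 1] (ψ₁ + s • ψ₂)) =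
      (κ₁ ^ (n + 1)) ^ 2 * (1 + q ^ 2) := by
    rw [l2_dressedMixture_self 1 h₁ h₂ he₁ he₂ hn₁ hn₂ h₁₂, p2 κ₁, p2 κ₂]; linear_combination hsY
  have e2 : l2 ((transferApply (1 : ℝ))^[n + 1] (ψ₁ + s • ψ₂)) (transferApply 1 ((transferApply 1)^[n + 1] (ψ₁ + s • ψ₂))) =
      (κ₁ ^ (n + 1)) ^ 2 * (κ₁ + q ^ 2 * κ₂) := by
    rw [l2_dressedMixture_transferApply 1 h₁ h₂ he₁ he₂ hn₁ hn₂ h₁₂, pow_succ κ₁ (2 * (n + 1)), pow_succ κ₂ (2 * (n + 1)), p2 κ₁, p2 κ₂]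
    linear_combination κ₂ * hsY
  have e4 : l2 ((transferApply (1 : ℝ))^[n + 1] (ψ₁ + s • ψ₂)) ((transferApply 1)^[n + 1] ((transferApply 1)^[n + 1] (ψ₁ + s • ψ₂))) =
      (κ₁ ^ (n + 1)) ^ 2 * (κ₁ ^ (n + 1) + q ^ 2 * κ₂ ^ (n + 1)) := by
    rw [← Function.iterate_add_apply, l2_mixture_iterate_iterate 1 h₁ h₂ he₁ he₂ hn₁ hn₂ h₁₂, p3 κ₁, p3 κ₂]
    linear_combination κ₂ ^ (n + 1) * hsY
  have e5 : l2 ((transferApply (1 : ℝ))^[n + 1] (ψ₁ + s • ψ₂)) ((transferApply 1)^[2 * (n + 1)] ((transferApply 1)^[n + 1] (ψ₁ + s • ψ₂))) =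
      (κ₁ ^ (n + 1)) ^ 2 * ((κ₁ ^ (n + 1)) ^ 2 + q ^ 2 * (κ₂ ^ (n + 1)) ^ 2) := by
    rw [← Function.iterate_add_apply, l2_mixture_iterate_iterate 1 h₁ h₂ he₁ he₂ hn₁ hn₂ h₁₂, p4 κ₁, p4 κ₂]
    linear_combination (κ₂ ^ (n + 1)) ^ 2 * hsY
  have hpos : 0 < l2 ((transferApply (1 : ℝ))^[n + 1] (ψ₁ + s • ψ₂)) ((transferApply 1)^[n + 1] (ψ₁ + s • ψ₂)) := by
    rw [e1]; positivity
  have hq8 : q ≤ 1 / 8 := by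
    rw [hq]; exact div_le_div_of_nonneg_left zero_le_one (by norm_num) (by nlinarith)
  have hδ0 : 0 ≤ q ^ 2 := sq_nonneg q
  have hδ : q ^ 2 ≤ 1 / 32 := by nlinarith
  have hdress : l2 ((transferApply (1 : ℝ))^[n + 1] (ψ₁ + s • ψ₂)) ((transferApply 1)^[2 * (n + 1)] ((transferApply 1)^[n + 1] (ψ₁ + s • ψ₂))) *
        l2 ((transferApply 1)^[n + 1] (ψ₁ + s • ψ₂)) ((transferApply 1)^[n + 1] (ψ₁ + s • ψ₂)) ≤
      (1 + q ^ 2) * l2 ((transferApply 1)^[n + 1] (ψ₁ + s • ψ₂)) ((transferApply 1)^[n + 1] ((transferApply 1)^[n + 1] (ψ₁ + s • ψ₂))) ^ 2 := by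
    rw [e5, e1, e4]
    exact dressedBlockDefect_farLowerAtom hXpos hYpos hYX q
  have hc := h 1 1 one_pos (ψ₁ + s • ψ₂) (h₁.add (h₂.smul s)) (n + 1) (by omega) (q ^ 2) hδ0 hδ hpos hdress
  rw [e4, e1, e2, Nat.add_sub_cancel] at hc
  exact farLowerAtom_contra hκ₁ hκ₂ hκ₂le rfl hYpos hq hn hc

end WithoutRaw

/-! ## §3 ★ (H2) is load-bearing for (b): without the DRESSED block defect no constant `c` works, already at `ℓ = 2` -/

section WithoutDressed

/-- ★ **`BlockToFine.reverse_jensen_root` is FALSE without its dressed-block-defect hypothesis (H2), for EVERY constant `c` in place of `15`, already at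
`ℓ = 2`.**  Witness: `L = 1`, `β = 1`, the upward atom `v = ψ₂ + (τr²)•ψ₁` over a physical eigenpair with `κ₂ = rκ₁`, `0 < r ≤ τ² = 1/(64(|c|+1)²)`, `δ := τ²`:
(H1) holds while `⟨u,K²u⟩‖u‖² ≥ κ₁^{10}r⁸τ²` against `e^{cτ²}⟨u,Ku⟩² ≤ (64/63)·4τ⁴·κ₁^{10}r⁸`. [folklore] -/
theorem reverse_jensen_root_false_without_dressed :
    ¬ ∃ c : ℝ, ∀ (L : ℕ) [NeZero L] (β : ℝ), 0 < β → ∀ (v : GaugeConfig 3 L SU2 → ℝ), IsPhys v → ∀ (ℓ : ℕ), 1 ≤ ℓ →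
      ∀ (δ : ℝ), 0 ≤ δ → δ ≤ 1 / 32 → 0 < l2 ((transferApply β)^[ℓ] v) ((transferApply β)^[ℓ] v) →
      l2 v ((transferApply β)^[2 * ℓ] v) * l2 v v ≤ (1 + δ) * l2 v ((transferApply β)^[ℓ] v) ^ 2 →
      l2 ((transferApply β)^[ℓ] v) ((transferApply β)^[ℓ] ((transferApply β)^[ℓ] v)) *
          l2 ((transferApply β)^[ℓ] v) ((transferApply β)^[ℓ] v) ^ (ℓ - 1) ≤
        Real.exp (c * δ) * l2 ((transferApply β)^[ℓ] v) (transferApply β ((transferApply β)^[ℓ] v)) ^ ℓ := by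
  rintro ⟨c, h⟩
  have habs : 0 ≤ |c| := abs_nonneg c
  obtain ⟨τ, hτpos, hτ⟩ : ∃ τ : ℝ, 0 < τ ∧ τ = 1 / (8 * (|c| + 1)) := ⟨_, by positivity, rfl⟩
  have hτ8 : τ ≤ 1 / 8 := by
    rw [hτ]; exact div_le_div_of_nonneg_left zero_le_one (by norm_num) (by nlinarith)
  have hρ : (0 : ℝ) < τ ^ 2 := by positivity
  have hρ1 : τ ^ 2 < 1 := by nlinarith
  obtain ⟨ψ₁, ψ₂, κ₁, κ₂, h₁, h₂, hn₁, hn₂, h₁₂, he₁, he₂, hκ₁, hκ₂, hle⟩ :=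
    exists_eigenpair_ratio_le (L := 1) (β := 1) one_pos hρ hρ1
  have h₂₁ : l2 ψ₂ ψ₁ = 0 := by rw [l2_comm]; exact h₁₂
  obtain ⟨r, hr, rfl⟩ : ∃ r : ℝ, 0 < r ∧ κ₂ = r * κ₁ := ⟨κ₂ / κ₁, div_pos hκ₂ hκ₁, (div_mul_cancel₀ κ₂ hκ₁.ne').symm⟩
  have hrt : r ≤ τ ^ 2 := le_of_mul_le_mul_right hle hκ₁
  have hr1 : r ≤ 1 := by nlinarith
  -- raw block data of the upward atom v = ψ₂ + (τr²)•ψ₁ at ℓ = 2 (roles of ψ₁, ψ₂ swapped in the two-level lemmas)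
  have hraw : l2 (ψ₂ + (τ * r ^ 2) • ψ₁) ((transferApply (1 : ℝ))^[2 * 2] (ψ₂ + (τ * r ^ 2) • ψ₁)) *
        l2 (ψ₂ + (τ * r ^ 2) • ψ₁) (ψ₂ + (τ * r ^ 2) • ψ₁) ≤
      (1 + τ ^ 2) * l2 (ψ₂ + (τ * r ^ 2) • ψ₁) ((transferApply (1 : ℝ))^[2] (ψ₂ + (τ * r ^ 2) • ψ₁)) ^ 2 := by
    rw [l2_mixture_self_iterate 1 h₂ h₁ he₂ he₁ hn₂ hn₁ h₂₁ (τ * r ^ 2) (2 * 2),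
      l2_weightedMixture_self (L := 1) 1 h₂ h₁ he₂ he₁ hn₂ hn₁ h₂₁ (τ * r ^ 2),
      l2_mixture_self_iterate 1 h₂ h₁ he₂ he₁ hn₂ hn₁ h₂₁ (τ * r ^ 2) 2]
    exact rawBlockDefect_upwardAtom_two τ hκ₁ hr hr1
  have hpos : 0 < l2 ((transferApply (1 : ℝ))^[2] (ψ₂ + (τ * r ^ 2) • ψ₁)) ((transferApply 1)^[2] (ψ₂ + (τ * r ^ 2) • ψ₁)) := by
    rw [l2_dressedMixture_self 1 h₂ h₁ he₂ he₁ hn₂ hn₁ h₂₁ (τ * r ^ 2) 2]; positivity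
  have hδ0 : 0 ≤ τ ^ 2 := sq_nonneg τ
  have hδ : τ ^ 2 ≤ 1 / 32 := by nlinarith
  have hc := h 1 1 one_pos (ψ₂ + (τ * r ^ 2) • ψ₁) (h₂.add (h₁.smul _)) 2 (by norm_num) (τ ^ 2) hδ0 hδ hpos hraw
  rw [← Function.iterate_add_apply, l2_mixture_iterate_iterate 1 h₂ h₁ he₂ he₁ hn₂ hn₁ h₂₁ (τ * r ^ 2) 2 (2 + 2),
    l2_dressedMixture_self 1 h₂ h₁ he₂ he₁ hn₂ hn₁ h₂₁ (τ * r ^ 2) 2,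
    l2_dressedMixture_transferApply 1 h₂ h₁ he₂ he₁ hn₂ hn₁ h₂₁ (τ * r ^ 2) 2] at hc
  exact upwardAtomTwo_contra hκ₁ hr hτ hrt hc

end WithoutDressed

end Summit.QuantumFields.YangMills.Theorems.FemtoTransferGap.PolyakovLift.Negative

end
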